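import Summits.NavierStokesRegularity.NavierStokesRegularity.Theses.PumpContinuation
import Summits.NavierStokesRegularity.NavierStokesRegularity.Theorems.PerpetualPumpThesisFloor
import Summits.NavierStokesRegularity.NavierStokesRegularity.Theorems.PerpetualPumpThesisBilinearOperatorForm
import Literature.Analysis.FluidPDE.TaoAveragedComplexAverageReal
import Literature.Analysis.FluidPDE.TaoAveragedCascadeAssembly
import Literature.Analysis.FluidPDE.TaoCascadeProjection

/-!
# Route PumpContinuation · cruxes `BoundedTemperatureClosed` / `EulerProximatePump` — tools:
# THE SEGMENT IS AVERAGED (the `H¹⁰_df` local theory holds at every segment point)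

The route's two cruxes (stmt-NavierStokesRegularity-18302/18303) are typed over the SEGMENT of trilinear
forms `T_θ = (1-θ)·B̃_𝒜 + θ·B` (`θ ∈ [0,1]`) joining the averaged Euler form `B̃_𝒜 = 𝒜.form` of a
symmetric cancelling averaging datum `𝒜` (Tao 2016, (1.12)–(1.13)) to the true Euler form `B`
(Tao 2016, (1.3)); the route file lists "the uniform-in-θ `H¹⁰` local theory … for the segment forms
(abstract, provable, layer-2 child of both cruxes)" as NOT DECOMPOSED. This file proves it, for every
averaging datum `𝒜` and EVERY REAL `θ` (no sign or size restriction), from the accepted Literature: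

* `exists_datum_form_eq_seg` — **the segment form is an averaged Euler form on `H¹⁰_df`**: there is an
  averaging datum `𝒜'` with `𝒜'.form u v w = (1-θ)·𝒜.form u v w + θ·B(u,v,w)` for all
  `u, v, w ∈ H¹⁰_df` (Tao 2016 §3.1–§3.2: averaged forms are complex averages of `B`
  (`AveragingDatum.isComplexAverageOf_form`), complex averages of `B` are closed under complex scalars
  and sums (`IsComplexAverageOf.smul_eulerForm`, `.add_eulerForm`), and a complex average of `B` that is
  real on real `H¹⁰_df` fields is an averaged Euler form (`complexAverage_isAveraged_holds`); realness
  from `PerpetualPumpThesis.B.form_im_eq_zero`). Symmetry and the cancellation property (1.16) are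
  inherited (`exists_datum_form_eq_seg_symm_canc`).
* `isMildSolutionFor_congr_memH10df` — Tao's mild formulation (1.15) on a time set star-shaped at `0`
  only evaluates the forcing form on `H¹⁰_df` triples `(u s, u s, e^{(t-s)Δ}w)`, so two forms agreeing on
  the `H¹⁰_df`-diagonal have the same mild solutions.
* Consequences at every segment point, transported from the in-tree theory for arbitrary averaging
  data (`PerpetualPumpThesis.stub_uniqueness`, `stub_thesis_LocalExistenceH10`,
  `stub_thesis_H10Continuation`, `stub_thesis_LerayFloorRate`): `seg_uniqueness` (mild solutions from
  the same datum agree), `seg_localExistence` (every `H¹⁰_df` datum launches a mild solution),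
  `seg_H10Continuation` (an `H¹⁰`-bounded mild solution from Schwartz data extends past its time),
  `seg_H10_unbounded_of_noExtension` (the blow-up criterion: no mild extension ⇒ the `H¹⁰` norm is
  unbounded on `[0,S)`), `seg_lerayFloorRate` (Leray's lower bound on the blow-up rate in the Besov
  envelope `Ḃ⁰_{∞,1}`, with a constant depending on `(𝒜, θ)`).

The file ends with the registered Tools stub `stub_segmentAveragedTools` (conjunction of the above).

## References

* T. Tao, *Finite time blowup for an averaged three-dimensional Navier–Stokes equation*, J. Amer.
  Math. Soc. 29 (2016), 601–674, arXiv:1402.0290v3, §1.1 (1.12)–(1.16), §3.1–§3.2. [Tao2016AveragedNS]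
-/

noncomputable section

-- the nested summit namespace `…NavierStokesRegularity.NavierStokesRegularity…` is the tree's layout (D-0017)
set_option linter.dupNamespace false

open MeasureTheory Set Filter Topology
open scoped ENNReal SchwartzMap
open Literature.Analysis.FluidPDE Literature.Analysis.FluidPDE.Tao2016

namespace Summit.NavierStokesRegularity.NavierStokesRegularity.Theorems.PumpContinuationSegmentAveraged

open Literature.Analysis.FunctionSpaces (eFourierSobolevNorm)
open Summit.NavierStokesRegularity.NavierStokesRegularity.Theorems.PerpetualPumpThesis
  (stub_uniqueness stub_thesis_LocalExistenceH10 stub_thesis_H10Continuation stub_thesis_LerayFloorRate)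

/-- The segment form `T_θ = (1-θ)·B̃_𝒜 + θ·B` of route PumpContinuation (verbatim the form in both
cruxes), for an averaging datum `𝒜` and a real parameter `θ`. -/
local notation3 "seg[" 𝒜 ", " θ "]" =>
  (fun a b c => ((1 - θ : ℝ) : ℂ) * AveragingDatum.form 𝒜 a b c +
    ((θ : ℝ) : ℂ) * Literature.Analysis.FluidPDE.Tao2016.eulerForm a b c)

/-! ### The mild formulation only sees the forcing form on the `H¹⁰_df`-diagonal -/

/-- **Transport of mild solutions between forms agreeing on the `H¹⁰_df`-diagonal.** If
`T(a,a,c) = T'(a,a,c)` whenever `a, c ∈ H¹⁰_df`, then on a time set `I` containing `[0,t]` (or `[t,0]`)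
together with each of its points `t`, every `T`-mild solution is a `T'`-mild solution: in (1.15) the
form is evaluated at `(u s, u s, e^{(t-s)Δ} w)` with `s` between `0` and `t`, `u s ∈ H¹⁰_df` by the
regularity clause and `e^{(t-s)Δ} w ∈ H¹⁰_df` (`MemH10df.heat`). [cite: Tao2016AveragedNS, §1.1 (1.15)] -/
theorem isMildSolutionFor_of_congr_memH10df {T T' : L2C → L2C → L2C → ℂ}
    (h : ∀ a c : L2C, MemH10df a → MemH10df c → T a a c = T' a a c) {u₀ : L2C} {I : Set ℝ}
    (hI : ∀ t ∈ I, uIcc 0 t ⊆ I) {u : ℝ → L2C} (hu : IsMildSolutionFor T u₀ I u) :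
    IsMildSolutionFor T' u₀ I u := by
  refine ⟨hu.1, hu.2.1, fun t ht w hw => ?_⟩
  rw [hu.2.2 t ht w hw]
  congr 1
  refine intervalIntegral.integral_congr fun s hs => ?_
  exact h _ _ (hu.1 s (hI t ht hs)) (hw.heat _)

/-- Two forms agreeing on the `H¹⁰_df`-diagonal have the same mild solutions on every time set
star-shaped at `0` (e.g. `[0,S)`, `[0,S]`, `[0,∞)`). [cite: Tao2016AveragedNS, §1.1 (1.15)] -/
theorem isMildSolutionFor_congr_memH10df {T T' : L2C → L2C → L2C → ℂ}
    (h : ∀ a c : L2C, MemH10df a → MemH10df c → T a a c = T' a a c) {u₀ : L2C} {I : Set ℝ}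
    (hI : ∀ t ∈ I, uIcc 0 t ⊆ I) {u : ℝ → L2C} :
    IsMildSolutionFor T u₀ I u ↔ IsMildSolutionFor T' u₀ I u :=
  ⟨fun hu => isMildSolutionFor_of_congr_memH10df h hI hu,
    fun hu => isMildSolutionFor_of_congr_memH10df (fun a c ha hc => (h a c ha hc).symm) hI hu⟩

/-- `[0,S)` is star-shaped at `0`. [folklore] -/
theorem uIcc_subset_Ico {S t : ℝ} (ht : t ∈ Ico (0 : ℝ) S) : uIcc 0 t ⊆ Ico 0 S := by
  intro s hs
  rw [uIcc_of_le ht.1] at hs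
  exact ⟨hs.1, hs.2.trans_lt ht.2⟩

/-- Same mild solutions on `[0,S)` for forms agreeing on the `H¹⁰_df`-diagonal. [cite: Tao2016AveragedNS, §1.1 (1.15)] -/
theorem isMildSolutionFor_Ico_congr_memH10df {T T' : L2C → L2C → L2C → ℂ}
    (h : ∀ a c : L2C, MemH10df a → MemH10df c → T a a c = T' a a c) {u₀ : L2C} {S : ℝ}
    {u : ℝ → L2C} :
    IsMildSolutionFor T u₀ (Ico 0 S) u ↔ IsMildSolutionFor T' u₀ (Ico 0 S) u :=
  isMildSolutionFor_congr_memH10df h fun _ ht => uIcc_subset_Ico ht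

/-! ### The segment form is an averaged Euler form on `H¹⁰_df` -/

/-- The Euler form is real on real `H¹⁰_df` fields (it is the form of the Euler datum). [cite: Tao2016AveragedNS, §3.1 p. 15] -/
theorem eulerForm_im_eq_zero {u v w : L2C} (hu : MemH10df u) (hv : MemH10df v) (hw : MemH10df w) :
    (eulerForm u v w).im = 0 := by
  rw [← AveragingDatum.euler_form]
  exact PerpetualPumpThesis.B.form_im_eq_zero AveragingDatum.euler hu.2.1 hv.2.1 hw.2.1

/-- **The segment form is a complex average of `B`** (Tao 2016, §3.2 ¶1: complex averages of `B` are
closed under complex scalar multiples and sums; `B̃_𝒜` and `B` are complex averages of `B`). [cite: Tao2016AveragedNS, §3.2 p. 15] -/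
theorem isComplexAverageOf_seg (𝒜 : AveragingDatum) (θ : ℝ) :
    IsComplexAverageOf seg[𝒜, θ] eulerForm :=
  (𝒜.isComplexAverageOf_form.smul_eulerForm ((1 - θ : ℝ) : ℂ)).add_eulerForm
    (isComplexAverageOf_eulerForm_self.smul_eulerForm ((θ : ℝ) : ℂ))

/-- The segment form is real on real `H¹⁰_df` fields (real coefficients, real summands). [cite: Tao2016AveragedNS, §3.1 p. 15] -/
theorem seg_im_eq_zero (𝒜 : AveragingDatum) (θ : ℝ) {u v w : L2C} (hu : MemH10df u) (hv : MemH10df v)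
    (hw : MemH10df w) : (seg[𝒜, θ] u v w).im = 0 := by
  simp only [Complex.add_im, Complex.im_ofReal_mul,
    PerpetualPumpThesis.B.form_im_eq_zero 𝒜 hu.2.1 hv.2.1 hw.2.1, eulerForm_im_eq_zero hu hv hw,
    mul_zero, add_zero]

/-- **The segment form is an averaged Euler form on `H¹⁰_df`**: for every averaging datum `𝒜` and
every real `θ` there is an averaging datum `𝒜'` (Tao 2016, (1.12)–(1.13): probability space, real
order-`0` symbols, rotations, bounded dilations) whose form agrees with `(1-θ)·B̃_𝒜 + θ·B` on
`H¹⁰_df × H¹⁰_df × H¹⁰_df` — Tao's §3.1 realisation of a real complex average as an average. [cite: Tao2016AveragedNS, §3.1 p. 15] -/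
theorem exists_datum_form_eq_seg (𝒜 : AveragingDatum) (θ : ℝ) :
    ∃ 𝒜' : AveragingDatum, ∀ u v w : L2C, MemH10df u → MemH10df v → MemH10df w →
      𝒜'.form u v w = seg[𝒜, θ] u v w :=
  complexAverage_isAveraged_holds _ (isComplexAverageOf_seg 𝒜 θ)
    (fun _ _ _ hu hv hw => seg_im_eq_zero 𝒜 θ hu hv hw)

/-- **… inheriting symmetry and the cancellation property (1.16)**: if `𝒜` is symmetric (resp.
cancelling) on `H¹⁰_df`, so is the datum `𝒜'` realising the segment form, for every real `θ` (the
Euler form is symmetric, `eulerForm_symm`, and cancelling on `H¹⁰_df`, `euler_hasCancellation`). [cite: Tao2016AveragedNS, §1.1 (1.16)] -/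
theorem exists_datum_form_eq_seg_symm_canc (𝒜 : AveragingDatum) (θ : ℝ) :
    ∃ 𝒜' : AveragingDatum, (∀ u v w : L2C, MemH10df u → MemH10df v → MemH10df w →
      𝒜'.form u v w = seg[𝒜, θ] u v w) ∧ (𝒜.IsSymmetric → 𝒜'.IsSymmetric) ∧
      (𝒜.HasCancellation → 𝒜'.HasCancellation) := by
  obtain ⟨𝒜', h⟩ := exists_datum_form_eq_seg 𝒜 θ
  refine ⟨𝒜', h, fun hs u v w hu hv hw => ?_, fun hc u hu => ?_⟩
  · rw [h u v w hu hv hw, h v u w hv hu hw]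
    simp only [hs u v w hu hv hw, eulerForm_symm u v w]
  · have hB : eulerForm u u u = 0 := by
      rw [← AveragingDatum.euler_form]
      exact AveragingDatum.euler_hasCancellation u hu
    rw [h u u u hu hu hu]
    simp only [hc u hu, hB, mul_zero, add_zero]

/-! ### Consequences: the `H¹⁰_df` local theory at every segment point -/

/-- **Uniqueness on the segment**: two `H¹⁰_df`-mild solutions of `∂ₜu = Δu + T_θ(u,u)` on `[0,S)`
with the same datum agree on `[0,S)` — every averaging datum, every real `θ` (transport of
`PerpetualPumpThesis.stub_uniqueness` along `exists_datum_form_eq_seg`). [cite: Tao2016AveragedNS, §1.1 (1.15)] -/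
theorem seg_uniqueness (𝒜 : AveragingDatum) (θ : ℝ) (a : L2C) (S : ℝ) (u v : ℝ → L2C)
    (hu : IsMildSolutionFor seg[𝒜, θ] a (Ico 0 S) u) (hv : IsMildSolutionFor seg[𝒜, θ] a (Ico 0 S) v) :
    ∀ t ∈ Ico 0 S, u t = v t := by
  obtain ⟨𝒜', h⟩ := exists_datum_form_eq_seg 𝒜 θ
  have h' : ∀ a c : L2C, MemH10df a → MemH10df c → seg[𝒜, θ] a a c = 𝒜'.form a a c :=
    fun a c ha hc => (h a a c ha ha hc).symm
  exact stub_uniqueness 𝒜' a S u v ((isMildSolutionFor_Ico_congr_memH10df h').1 hu)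
    ((isMildSolutionFor_Ico_congr_memH10df h').1 hv)

/-- **Local existence on the segment**: every `a ∈ H¹⁰_df` is the datum of an `H¹⁰_df`-mild solution
of `∂ₜu = Δu + T_θ(u,u)` on some `[0,S)`, `S > 0` — every averaging datum, every real `θ`. [cite: Tao2016AveragedNS, §1.1 (1.15)] -/
theorem seg_localExistence (𝒜 : AveragingDatum) (θ : ℝ) (a : L2C) (ha : MemH10df a) :
    ∃ S : ℝ, 0 < S ∧ ∃ u : ℝ → L2C, IsMildSolutionFor seg[𝒜, θ] a (Ico 0 S) u := by
  obtain ⟨𝒜', h⟩ := exists_datum_form_eq_seg 𝒜 θ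
  obtain ⟨S, hS, u, hu⟩ := stub_thesis_LocalExistenceH10 𝒜' a ha
  have h' : ∀ a c : L2C, MemH10df a → MemH10df c → 𝒜'.form a a c = seg[𝒜, θ] a a c :=
    fun a c ha hc => h a a c ha ha hc
  exact ⟨S, hS, u, (isMildSolutionFor_Ico_congr_memH10df h').1 hu⟩

/-- **`H¹⁰` continuation criterion on the segment**: an `H¹⁰_df`-mild solution of
`∂ₜu = Δu + T_θ(u,u)` on `[0,S)` from a Schwartz divergence-free datum whose `H¹⁰` norm is bounded on
`[0,S)` has a mild extension past `S` — every averaging datum, every real `θ`. [cite: Tao2016AveragedNS, §1.1 (1.15)] -/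
theorem seg_H10Continuation (𝒜 : AveragingDatum) (θ : ℝ)
    (u₀ : 𝓢(EuclideanSpace ℝ (Fin 3), EuclideanSpace ℝ (Fin 3))) (hdiv : VectorCalculus.IsDivFree ⇑u₀)
    (S : ℝ) (hS : 0 < S) (u : ℝ → L2C) (hu : IsMildSolutionFor seg[𝒜, θ] (schwartzL2 u₀) (Ico 0 S) u)
    (hbd : ∃ C : ℝ, ∀ t ∈ Ico 0 S, eFourierSobolevNorm 10 (u t) ≤ ENNReal.ofReal C) :
    ∃ S' : ℝ, S < S' ∧ ∃ v : ℝ → L2C,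
      IsMildSolutionFor seg[𝒜, θ] (schwartzL2 u₀) (Ico 0 S') v ∧ ∀ t ∈ Ico 0 S, v t = u t := by
  obtain ⟨𝒜', h⟩ := exists_datum_form_eq_seg 𝒜 θ
  have h' : ∀ a c : L2C, MemH10df a → MemH10df c → 𝒜'.form a a c = seg[𝒜, θ] a a c :=
    fun a c ha hc => h a a c ha ha hc
  have hu' : 𝒜'.IsMildSolution (schwartzL2 u₀) (Ico 0 S) u :=
    (isMildSolutionFor_Ico_congr_memH10df h').2 hu
  obtain ⟨S', hSS', v, hv, hvu⟩ := stub_thesis_H10Continuation 𝒜' u₀ hdiv S hS u hu' hbd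
  exact ⟨S', hSS', v, (isMildSolutionFor_Ico_congr_memH10df h').1 hv, hvu⟩

/-- **Blow-up criterion on the segment**: if an `H¹⁰_df`-mild solution of `∂ₜu = Δu + T_θ(u,u)` on
`[0,S)` from a Schwartz divergence-free datum has NO mild extension past `S`, its `H¹⁰` norm is
unbounded on `[0,S)` (contrapositive of `seg_H10Continuation`). [cite: Tao2016AveragedNS, §1.1 (1.15)] -/
theorem seg_H10_unbounded_of_noExtension (𝒜 : AveragingDatum) (θ : ℝ)
    (u₀ : 𝓢(EuclideanSpace ℝ (Fin 3), EuclideanSpace ℝ (Fin 3))) (hdiv : VectorCalculus.IsDivFree ⇑u₀)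
    (S : ℝ) (hS : 0 < S) (u : ℝ → L2C) (hu : IsMildSolutionFor seg[𝒜, θ] (schwartzL2 u₀) (Ico 0 S) u)
    (hno : ¬ ∃ S' : ℝ, S < S' ∧ ∃ v : ℝ → L2C,
      IsMildSolutionFor seg[𝒜, θ] (schwartzL2 u₀) (Ico 0 S') v ∧ ∀ t ∈ Ico 0 S, v t = u t) :
    ∀ C : ℝ, ∃ t ∈ Ico 0 S, ENNReal.ofReal C < eFourierSobolevNorm 10 (u t) := by
  intro C
  by_contra hC
  push Not at hC
  exact hno (seg_H10Continuation 𝒜 θ u₀ hdiv S hS u hu ⟨C, hC⟩)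

/-- **Leray's lower bound on the blow-up rate on the segment, in the Besov envelope**: for every
averaging datum `𝒜` and real `θ` there is `ε = ε(𝒜, θ) > 0` such that an `H¹⁰_df`-mild solution of
`∂ₜu = Δu + T_θ(u,u)` on `[0,S)` from a Schwartz divergence-free datum with no mild extension past `S`
satisfies `√(S-t) ‖u(t)‖_{Ḃ⁰_{∞,1}} > ε` at every `t ∈ [0,S)` (transport of
`stub_thesis_LerayFloorRate`). [cite: Tao2016AveragedNS, §1.1 (1.15)] -/
theorem seg_lerayFloorRate (𝒜 : AveragingDatum) (θ : ℝ) :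
    ∃ ε : ℝ, 0 < ε ∧ ∀ u₀ : 𝓢(EuclideanSpace ℝ (Fin 3), EuclideanSpace ℝ (Fin 3)),
      VectorCalculus.IsDivFree ⇑u₀ → ∀ S : ℝ, 0 < S → ∀ u : ℝ → L2C,
      IsMildSolutionFor seg[𝒜, θ] (schwartzL2 u₀) (Ico 0 S) u →
      (¬ ∃ S' : ℝ, S < S' ∧ ∃ v : ℝ → L2C,
        IsMildSolutionFor seg[𝒜, θ] (schwartzL2 u₀) (Ico 0 S') v ∧ ∀ t ∈ Ico 0 S, v t = u t) →
      ∀ t ∈ Ico 0 S, ENNReal.ofReal ε < ENNReal.ofReal (Real.sqrt (S - t)) *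
        Literature.Analysis.FunctionSpaces.eHomBesovNorm 0 ⊤ 1
          ((u t : L2C) : 𝓢'(EuclideanSpace ℝ (Fin 3), EuclideanSpace ℂ (Fin 3))) := by
  obtain ⟨𝒜', h⟩ := exists_datum_form_eq_seg 𝒜 θ
  have h' : ∀ a c : L2C, MemH10df a → MemH10df c → 𝒜'.form a a c = seg[𝒜, θ] a a c :=
    fun a c ha hc => h a a c ha ha hc
  obtain ⟨ε, hε, hfloor⟩ := stub_thesis_LerayFloorRate 𝒜'
  refine ⟨ε, hε, fun u₀ hdiv S hS u hu hno t ht => ?_⟩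
  have hu' : 𝒜'.IsMildSolution (schwartzL2 u₀) (Ico 0 S) u :=
    (isMildSolutionFor_Ico_congr_memH10df h').2 hu
  refine hfloor u₀ hdiv S hS u hu' (fun ⟨S', hSS', v, hv, hvu⟩ => hno ⟨S', hSS', v, ?_, hvu⟩) t ht
  exact (isMildSolutionFor_Ico_congr_memH10df h').1 hv

/-! ### The registered Tools stub -/

/-- **Stub (tools: the segment is averaged; `H¹⁰_df` local theory at every segment point).** Registered
with `ledger workitem stub-add stmt-NavierStokesRegularity-18303 --name stub_segmentAveragedTools`:
(i) forms agreeing on the `H¹⁰_df`-diagonal have the same mild solutions on `[0,S)`; (ii) for every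
averaging datum `𝒜` and real `θ` the segment form `(1-θ)·B̃_𝒜 + θ·B` agrees on `H¹⁰_df` with the form
of an averaging datum, symmetric / cancelling when `𝒜` is; (iii) uniqueness, (iv) local existence,
(v) the `H¹⁰` continuation criterion and (vi) Leray's floor on the blow-up rate in `Ḃ⁰_{∞,1}` for the
mild solutions of `∂ₜu = Δu + T_θ(u,u)`, every `𝒜`, every real `θ`. [cite: Tao2016AveragedNS, §1.1 (1.15), §3.1–§3.2] -/
theorem stub_segmentAveragedTools :
    (∀ (T T' : L2C → L2C → L2C → ℂ), (∀ a c : L2C, MemH10df a → MemH10df c → T a a c = T' a a c) → ∀ (u₀ : L2C) (S : ℝ) (u : ℝ → L2C), IsMildSolutionFor T u₀ (Ico 0 S) u ↔ IsMildSolutionFor T' u₀ (Ico 0 S) u) ∧ (∀ (𝒜 : AveragingDatum) (θ : ℝ), ∃ 𝒜' : AveragingDatum, (∀ u v w : L2C, MemH10df u → MemH10df v → MemH10df w → 𝒜'.form u v w = ((1 - θ : ℝ) : ℂ) * 𝒜.form u v w + ((θ : ℝ) : ℂ) * eulerForm u v w) ∧ (𝒜.IsSymmetric → 𝒜'.IsSymmetric)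 ∧ (𝒜.HasCancellation → 𝒜'.HasCancellation)) ∧ (∀ (𝒜 : AveragingDatum) (θ : ℝ) (a : L2C) (S : ℝ) (u v : ℝ → L2C), IsMildSolutionFor (fun a b c => ((1 - θ : ℝ) : ℂ) * 𝒜.form a b c + ((θ : ℝ) : ℂ) * eulerForm a b c) a (Ico 0 S) u → IsMildSolutionFor (fun a b c => ((1 - θ : ℝ) : ℂ) * 𝒜.form a b c + ((θ : ℝ) : ℂ) * eulerForm a b c) a (Ico 0 S) v → ∀ t ∈ Ico 0 S, u t = v t) ∧ (∀ (𝒜 : AveragingDatum) (θ : ℝ) (a : L2C), MemH10df a → ∃ S : ℝ, 0 < S ∧ ∃ u : ℝ → L2C, IsMildSolutionFor (fun a b c => ((1 - θ : ℝ) : ℂ) * 𝒜.form a b c + ((θ : ℝ) : ℂ) * eulerForm a b c) a (Ico 0 S) u) ∧ (∀ (𝒜 : AveragingDatum) (θ : ℝ) (u₀ : SchwartzMap (EuclideanSpace ℝ (Fin 3)) (EuclideanSpace ℝ (Fin 3))), VectorCalculus.IsDivFree ⇑u₀ → ∀ S : ℝ, 0 < S → ∀ u : ℝ → L2C, IsMildSolutionFor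 (fun a b c => ((1 - θ : ℝ) : ℂ) * 𝒜.form a b c + ((θ : ℝ) : ℂ) * eulerForm a b c) (schwartzL2 u₀) (Ico 0 S) u → (∃ C : ℝ, ∀ t ∈ Ico 0 S, eFourierSobolevNorm 10 (u t) ≤ ENNReal.ofReal C) → ∃ S' : ℝ, S < S' ∧ ∃ v : ℝ → L2C, IsMildSolutionFor (fun a b c => ((1 - θ : ℝ) : ℂ) * 𝒜.form a b c + ((θ : ℝ) : ℂ) * eulerForm a b c) (schwartzL2 u₀) (Ico 0 S') v ∧ ∀ t ∈ Ico 0 S, v t = u t) ∧ (∀ (𝒜 : AveragingDatum) (θ : ℝ), ∃ ε : ℝ, 0 < ε ∧ ∀ u₀ : SchwartzMap (EuclideanSpace ℝ (Fin 3)) (EuclideanSpace ℝ (Fin 3)), VectorCalculus.IsDivFree ⇑u₀ → ∀ S : ℝ, 0 < S → ∀ u : ℝ → L2C, IsMildSolutionFor (fun a b c => ((1 - θ : ℝ) : ℂ) * 𝒜.form a b c + ((θ : ℝ) : ℂ) * eulerForm a b c) (schwartzL2 u₀) (Ico 0 S) u → (¬ ∃ S' : ℝ, S < S' ∧ ∃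 v : ℝ → L2C, IsMildSolutionFor (fun a b c => ((1 - θ : ℝ) : ℂ) * 𝒜.form a b c + ((θ : ℝ) : ℂ) * eulerForm a b c) (schwartzL2 u₀) (Ico 0 S') v ∧ ∀ t ∈ Ico 0 S, v t = u t) → ∀ t ∈ Ico 0 S, ENNReal.ofReal ε < ENNReal.ofReal (Real.sqrt (S - t)) * Literature.Analysis.FunctionSpaces.eHomBesovNorm 0 ⊤ 1 ((u t : L2C) : TemperedDistribution (EuclideanSpace ℝ (Fin 3)) (EuclideanSpace ℂ (Fin 3)))) :=
  ⟨fun _ _ h _ _ _ => isMildSolutionFor_Ico_congr_memH10df h, exists_datum_form_eq_seg_symm_canc,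
    seg_uniqueness, seg_localExistence, seg_H10Continuation, seg_lerayFloorRate⟩

end Summit.NavierStokesRegularity.NavierStokesRegularity.Theorems.PumpContinuationSegmentAveraged

end
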